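import Summits.QuantumFields.BalabanUV.Beta.WardLocusRecursiveLetters
import Summits.QuantumFields.BalabanUV.Beta.WilsonWardColourFree

/-!
# `BalabanUV.Beta.WardLocusParitySplit` — binder row D1, (L4) W-side of hW: THE PARITY SPLIT OF THE hW WARD LETTERS — the residual slots of
# the hW END absorb the ODD HALF of every Ward divergence for free; the CONTENT of a letter is its EVEN-HALF LAW; and THE hW END FROM THE EVEN-HALF LAWS ALONE
# (β sub-cell, D1 formalisation swarm, unit `b2b-balaban-beta-d1-formalise-leaf-06`, gen 3; complements the owner's NOTE X-an2-47∕-K `SecondOrderLetterParity`)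

NOT IN PRINT; OUR BOOKKEEPING.  HONEST FRAMING (cell charter, verbatim): «discharging `BetaPertH` makes Bałaban's UV stability UNCONDITIONAL — a real
constructive-QFT result; it is NOT the continuum limit and NOT the Clay problem.»  HONEST DEPENDENCY (verbatim): «continuum YM on T⁴ ⇐ BetaPertH ∧ nine spine
estimates (0/9 proved); BetaPertH ⇐ (D1) ∧ (D4) ∧ CAP+tail; G-an2-4 gates asym, D1 and NE2/3/4.»  [folklore] entrywise kernel algebra and exponential
bookkeeping; no statement of Bałaban's papers, no `[cite:]`, no `def`, no `def … : Prop`; instantiates NO binder of the β-function wall.  NOT hW, NOT D1,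
NOT `BetaPertH`, NOT continuum, NOT Clay.

READING.  The hW END `WardLocusRecursiveLetters.wardTransversal_flipK_TbalOf_JsRecWAtOf_of_letters` asks for letters `L = C + R` with a residual `R` that is
row-parity-ODD (`trK R = −sgnK R`) and of a localisation class.  For ANY kernel `L` the ODD HALF `½ • (L − sgnK (trK L))` is row-parity-odd (§1
`parityOdd_oddHalf`) and inherits every diagonal bi-localisation of `L` (§2 `biLoc_oddHalf`); and `L = C + oddHalf L` is EQUIVALENT to the EVEN-HALF LAW
`L + sgnK (trK L) = 2 • C` (§1 `letter_of_evenHalf_law`).  So the residual slots cost nothing: the CONTENT of each hW letter is the even-half law of the Ward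
divergence of an1's table against the (parity-even) commutator term — for a TWIN (odd) table the even half of `L` is `0` and the law FAILS (owner's
X-an2-47: no twin model), for an ANTI-TWIN (even) table it is the EXACT law, and for a general table it constrains the even part only.  §3 supplies the
classes of the odd halves of the three hW divergences UNIFORMLY in the block variable, from `LocStencil₂` ∕ `LocStencilFM` alone (re-centring at half rate).

* §1 `parityOdd_oddHalf`, `letter_of_evenHalf_law`, `evenHalf_law_of_letter` (converse, for an even `C` and odd `R`), `evenHalf_eq_zero_of_odd` (twin ⇒ even
  half `0`: the law forces `C = 0`), `evenHalf_law_iff_of_even` (anti-twin ⇒ the law is the exact identity `L = C`).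
* §2 `biLoc_oddHalf`, `biLoc_recenter_half` (`BiLoc K u u (C·e^{−δ|u′−u|}) δ ⇒ BiLoc K u′ u′ C (δ/2)`), `biLoc_smul_sum_divV` (a scaled block sum of
  divergences of a family uniformly bi-localised at `p` is bi-localised at `p`).
* §3 `locStencil_oddHalf_border` ∕ `locStencil_oddHalf_border''` ∕ `vertexFamily_oddHalf_mixed`: the residual classes of the hW END for the odd halves of
  the border (both slots) and mixed Ward divergences, constants uniform in the block variable.
* §4 **`wardTransversal_flipK_TbalOf_JsRecWAtOf_TW_su_of_evenHalf_laws`** (`d = 3`, `T_W := (8N²)⁻¹ • wsym22 N`, every `SU(N)` with `2 ≤ N`, NO colour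
  hypothesis, pin `cE₂ = Lc^{2(3+1)}`): hW(v2.26-W) for the recursive W-literal ⟸ EXACTLY the five EVEN-HALF WARD LAWS `L + sgnK (trK L) = 2 • [main, D]`
  (border divergence both slots at level 0 and every level j+1, mixed divergence every level) + `hBt`∕`hmixt` — NO residual tables, NO class binders, NO parity
  binders (the END `…_of_letters` with `RW = RW″ = 0` by `WilsonWardColourFree.hWil_wilson_TW_su`∕`''` and the other residuals := the odd halves).
Provenance: D1 formalisation swarm, leaf prover 06 (gen 3), 2026-08-20; no existing file touched.
-/

noncomputable section

open Finset
open scoped BigOperators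
open Literature.MathematicalPhysics.QuantumFieldTheory
open Literature.MathematicalPhysics.QuantumFieldTheory.Balaban1983to89
open Literature.MathematicalPhysics.QuantumFieldTheory.Balaban1983to89.Beta
open Literature.MathematicalPhysics.QuantumFieldTheory.Balaban1983to89.B12Sec2to5 (l1 l1_nonneg)
open ExpKernelCalculus (MKer BiLoc VertexFamily l1_sub_triangle)
open KernelWard (divV biLoc_add biLoc_sub biLoc_finset_sum)
open AffineAveraging (Site box toSite)
open OneStepResolventKernel (Fib LocStencil)
open SecondOrderResponse (LocStencilFM biLoc_smul)
open BalabanCompositeJets (LocStencil₂)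
open StepJetData (wilsonA biLoc_weaken)
open PolarizationSign (WardTransversal)
open BalabanStepJetsSucc (wE wVH)
open BalabanStepW2 (M2Of wV4 wB2 wM2)
open WilsonVertex2Sym (wsym22)
open AveragingHessianKernelsRooted (vhSAt)
open ExpKernelCalculus (comp shiftK)
open OneStepKernelFamily (l1_neg_eq KInvStep TbalOf flipK)
open Summit.QuantumFields.BalabanUV.Beta.TameKernelCalculus
open Summit.QuantumFields.BalabanUV.Beta.BorderedHessian (sgnF sgnF_mul_self sgnK sgnK_apply sgnK_sgnK trK_sgnK)
open Summit.QuantumFields.BalabanUV.Beta.SpineRecursiveParity (sgnK_smul trK_smul)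
open Summit.QuantumFields.BalabanUV.Beta.KernelWardRemainderParity (sgnK_add)
open Summit.QuantumFields.BalabanUV.Beta.BubbleParity (sgnK_neg)
open Summit.QuantumFields.BalabanUV.Beta.BorderedHessian (diagK stepScale)
open Summit.QuantumFields.BalabanUV.Beta.AveragingWardRootedStencils (legInd)
open Summit.QuantumFields.BalabanUV.Beta.SpineRooted (M1At JsRecWAtOf)
open Summit.QuantumFields.BalabanUV.Beta.SpineRecursiveParity (parityOdd_zero)
open Summit.QuantumFields.BalabanUV.Beta.WilsonWardColourFree (hWil_wilson_TW_su hWil''_wilson_TW_su)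
open Summit.QuantumFields.BalabanUV.Beta.WardLocusRecursiveLetters (wardTransversal_flipK_TbalOf_JsRecWAtOf_of_letters)

namespace Summit.QuantumFields.BalabanUV.Beta.WardLocusParitySplit

variable {d : ℕ}

/-! ## §1 The odd half of a kernel -/

/-- [folklore] `sgnK` commutes with subtraction. -/
theorem sgnK_sub (A B : MKer (d + 1) (Fib d)) : sgnK (A - B) = sgnK A - sgnK B := by
  rw [sub_eq_add_neg, sgnK_add, sgnK_neg, ← sub_eq_add_neg]

/-- [folklore] **THE ODD HALF `½ • (L − sgnK (trK L))` OF ANY KERNEL IS ROW-PARITY-ODD.** -/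
theorem parityOdd_oddHalf (L : MKer (d + 1) (Fib d)) :
    trK (((1 : ℝ) / 2) • (L - sgnK (trK L))) = -sgnK (((1 : ℝ) / 2) • (L - sgnK (trK L))) := by
  rw [trK_smul, trK_sub, trK_sgnK, trK_trK, sgnK_smul, sgnK_sub, sgnK_sgnK, ← smul_neg, neg_sub]

/-- [folklore] **THE EVEN-HALF LAW GIVES THE LETTER WITH THE ODD HALF AS RESIDUAL**: `L + sgnK (trK L) = 2 • C` ⇒ `L = C + ½ • (L − sgnK (trK L))`. -/
theorem letter_of_evenHalf_law {L C : MKer (d + 1) (Fib d)} (h : L + sgnK (trK L) = (2 : ℝ) • C) :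
    L = C + ((1 : ℝ) / 2) • (L - sgnK (trK L)) := by
  funext x z a b
  have e := congrFun (congrFun (congrFun (congrFun h x) z) a) b
  simp only [Pi.add_apply, Pi.smul_apply, Pi.sub_apply, smul_eq_mul] at e ⊢
  linarith

/-- [folklore] **CONVERSELY, A LETTER WITH AN EVEN MAIN TERM AND AN ODD RESIDUAL IS ITS EVEN-HALF LAW**: `L = C + R`, `trK C = sgnK C`, `trK R = −sgnK R`
⇒ `L + sgnK (trK L) = 2 • C` (and then `R` is the odd half of `L`). -/
theorem evenHalf_law_of_letter {L C R : MKer (d + 1) (Fib d)} (hC : trK C = sgnK C) (hR : trK R = -sgnK R) (h : L = C + R) :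
    L + sgnK (trK L) = (2 : ℝ) • C := by
  rw [h, trK_add, hC, hR, sgnK_add, sgnK_sgnK, sgnK_neg, sgnK_sgnK, two_smul]
  abel

/-- [folklore] **A ROW-PARITY-ODD (TWIN) DIVERGENCE HAS EVEN HALF ZERO** — so its even-half law reads `0 = 2 • C` and forces the commutator term to
vanish (the owner's «no twin model», X-an2-47). -/
theorem evenHalf_eq_zero_of_odd {L : MKer (d + 1) (Fib d)} (hL : trK L = -sgnK L) : L + sgnK (trK L) = 0 := by
  rw [hL, sgnK_neg, sgnK_sgnK, add_neg_cancel]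

/-- [folklore] **A ROW-PARITY-EVEN (ANTI-TWIN) DIVERGENCE HAS EVEN HALF `2 • L`** — so its even-half law IS the exact Ward identity `L = C`. -/
theorem evenHalf_law_iff_of_even {L C : MKer (d + 1) (Fib d)} (hL : trK L = sgnK L) : L + sgnK (trK L) = (2 : ℝ) • C ↔ L = C := by
  rw [hL, sgnK_sgnK, ← two_smul ℝ L]
  constructor
  · intro h
    have := congrArg (fun K : MKer (d + 1) (Fib d) => ((1 : ℝ) / 2) • K) h
    simp only [smul_smul] at this
    norm_num at this
    exact this
  · intro h; rw [h]

/-! ## §2 Bi-localisation bookkeeping -/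

/-- [folklore] **THE ODD HALF INHERITS A DIAGONAL BI-LOCALISATION** (the transpose swaps the two legs, the signs have modulus one). -/
theorem biLoc_oddHalf {L : MKer (d + 1) (Fib d)} {p : Fin (d + 1) → ℤ} {C δ : ℝ} (h : BiLoc L p p C δ) :
    BiLoc (((1 : ℝ) / 2) • (L - sgnK (trK L))) p p C δ := by
  intro x z a b
  have h1 := h x z a b
  have h2 := h z x b a
  rw [add_comm (l1 (z - p))] at h2
  have hs : |sgnF a * sgnF b| = 1 := by
    have ha : |sgnF (d := d) a| = 1 := by rcases a with κ | κ <;> simp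
    have hb : |sgnF (d := d) b| = 1 := by rcases b with κ | κ <;> simp
    rw [abs_mul, ha, hb, mul_one]
  simp only [Pi.smul_apply, Pi.sub_apply, smul_eq_mul, sgnK_apply, trK_apply]
  rw [abs_mul, abs_of_pos (by norm_num : (0 : ℝ) < 1 / 2)]
  have h3 : |sgnF a * sgnF b * L z x b a| ≤ C * Real.exp (-δ * (l1 (x - p) + l1 (z - p))) := by
    rw [abs_mul, hs, one_mul]; exact h2
  have h4 := abs_sub (L x z a b) (sgnF a * sgnF b * L z x b a)
  nlinarith [h4, h1, h3, abs_nonneg (L x z a b - sgnF a * sgnF b * L z x b a)]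

/-- [folklore] **RE-CENTRING AT HALF RATE**: a kernel bi-localised at `u` with a constant decaying in `|u′ − u|` is bi-localised at `u′` with the bare
constant and half the rate — `|x−u′| + |z−u′| ≤ |x−u| + |z−u| + 2|u′−u|`. -/
theorem biLoc_recenter_half {K : MKer (d + 1) (Fib d)} {u u' : Fin (d + 1) → ℤ} {C δ : ℝ} (hC : 0 ≤ C) (hδ : 0 ≤ δ)
    (h : BiLoc K u u (C * Real.exp (-δ * l1 (u' - u))) δ) : BiLoc K u' u' C (δ / 2) := by
  intro x z a b
  refine (h x z a b).trans ?_
  rw [mul_assoc, ← Real.exp_add]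
  refine mul_le_mul_of_nonneg_left (Real.exp_le_exp.2 ?_) hC
  have e1 : l1 (x - u') ≤ l1 (x - u) + l1 (u - u') := l1_sub_triangle x u u'
  have e2 : l1 (z - u') ≤ l1 (z - u) + l1 (u - u') := l1_sub_triangle z u u'
  have e3 : l1 (u - u') = l1 (u' - u) := by rw [← neg_sub, l1_neg_eq]
  have e4 := l1_nonneg (x - u)
  have e5 := l1_nonneg (z - u)
  nlinarith

/-- [folklore] The same with the separation written `|u − q|` (the `LocStencilFM` convention, `q` the coarse anchor). -/
theorem biLoc_recenter_half' {K : MKer (d + 1) (Fib d)} {u q : Fin (d + 1) → ℤ} {C δ : ℝ} (hC : 0 ≤ C) (hδ : 0 ≤ δ)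
    (h : BiLoc K u u (C * Real.exp (-δ * l1 (u - q))) δ) : BiLoc K q q C (δ / 2) := by
  rw [← l1_neg_eq, neg_sub] at h
  exact biLoc_recenter_half hC hδ h

/-- [folklore] **A SCALED BLOCK SUM OF DIVERGENCES OF A FAMILY UNIFORMLY BI-LOCALISED AT `p` IS BI-LOCALISED AT `p`** (constant
`|c| · #s · (d+1) · 2C`). -/
theorem biLoc_smul_sum_divV {F : Fin (d + 1) → (Fin (d + 1) → ℤ) → MKer (d + 1) (Fib d)} {p : Fin (d + 1) → ℤ} {C δ : ℝ}
    (h : ∀ κ u, BiLoc (F κ u) p p C δ) (c : ℝ) {ι : Type*} (s : Finset ι) (g : ι → Fin (d + 1) → ℤ) :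
    BiLoc (c • ∑ i ∈ s, divV F (g i)) p p (|c| * ∑ _i ∈ s, ∑ _κ : Fin (d + 1), (C + C)) δ := by
  refine biLoc_smul c (biLoc_finset_sum s fun i _ => ?_)
  unfold divV
  exact biLoc_finset_sum _ fun κ _ => biLoc_sub (h κ _) (h κ _)

/-! ## §3 The residual classes of the odd halves of the three hW Ward divergences, uniformly in the block variable -/

section Classes

variable {Lc : ℕ}

/-- [folklore] **BORDER DIVERGENCE, FIRST SLOT**: for a `LocStencil₂` table `S₂` (rate `δ > 0`) the kernels
`Y ↦ (κ′, u′) ↦ a • Σ_{v ∈ box} divV (fun κ u => w • S₂ κ u κ′ u′) (Lc•Y + v)` and their odd halves are `LocStencil` families with ONE constant and rate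
`δ/2`, uniformly in `Y`. -/
theorem locStencil_oddHalf_border {S₂ : Fin (d + 1) → (Fin (d + 1) → ℤ) → Fin (d + 1) → (Fin (d + 1) → ℤ) → MKer (d + 1) (Fib d)} {C δ : ℝ}
    (hS : LocStencil₂ S₂ C δ) (hδ : 0 < δ) (a w : ℝ) (Y : Fin (d + 1) → ℤ) :
    LocStencil (fun κ' u' => ((1 : ℝ) / 2) • ((a • ∑ v ∈ box (d + 1) Lc, divV (fun κ u => w • S₂ κ u κ' u') ((Lc : ℤ) • Y + toSite v))
        - sgnK (trK (a • ∑ v ∈ box (d + 1) Lc, divV (fun κ u => w • S₂ κ u κ' u') ((Lc : ℤ) • Y + toSite v)))))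
      (|a| * ∑ _i ∈ box (d + 1) Lc, ∑ _κ : Fin (d + 1), (|w| * C + |w| * C)) (δ / 2) := by
  intro κ' u'
  have hC : 0 ≤ C := by
    have := (hS 0 0 0 0).nonneg (Sum.inl 0)
    have hpos := Real.exp_pos (-δ * l1 ((0 : Fin (d + 1) → ℤ) - 0))
    nlinarith [this, hpos]
  refine biLoc_oddHalf (biLoc_smul_sum_divV (fun κ u => ?_) a _ _)
  have h1 : BiLoc (S₂ κ u κ' u') u' u' C (δ / 2) := biLoc_recenter_half hC hδ.le (hS κ u κ' u')
  exact biLoc_smul w h1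

/-- [folklore] **BORDER DIVERGENCE, SECOND SLOT** (the divergence acts on the second bond; the free bond `(κ, u)` is the localisation centre). -/
theorem locStencil_oddHalf_border'' {S₂ : Fin (d + 1) → (Fin (d + 1) → ℤ) → Fin (d + 1) → (Fin (d + 1) → ℤ) → MKer (d + 1) (Fib d)} {C δ : ℝ}
    (hS : LocStencil₂ S₂ C δ) (hδ : 0 < δ) (a w : ℝ) (Y : Fin (d + 1) → ℤ) :
    LocStencil (fun κ u => ((1 : ℝ) / 2) • ((a • ∑ v ∈ box (d + 1) Lc, divV (fun κ' u' => w • S₂ κ u κ' u') ((Lc : ℤ) • Y + toSite v))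
        - sgnK (trK (a • ∑ v ∈ box (d + 1) Lc, divV (fun κ' u' => w • S₂ κ u κ' u') ((Lc : ℤ) • Y + toSite v)))))
      (|a| * ∑ _i ∈ box (d + 1) Lc, ∑ _κ : Fin (d + 1), (|w| * C + |w| * C)) (δ / 2) := by
  intro κ u
  have hC : 0 ≤ C := by
    have := (hS 0 0 0 0).nonneg (Sum.inl 0)
    have hpos := Real.exp_pos (-δ * l1 ((0 : Fin (d + 1) → ℤ) - 0))
    nlinarith [this, hpos]
  refine biLoc_oddHalf (biLoc_smul_sum_divV (fun κ' u' => ?_) a _ _)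
  have h0 := hS κ u κ' u'
  have h1 : BiLoc (S₂ κ u κ' u') u u C (δ / 2) := by
    refine biLoc_weaken h0 ?_ (by linarith)
    have := Real.exp_le_one_iff.2 (show -δ * l1 (u' - u) ≤ 0 by nlinarith [l1_nonneg (u' - u)])
    nlinarith
  exact biLoc_smul w h1

/-- [folklore] **MIXED DIVERGENCE**: for a `LocStencilFM Lc` table `M` (rate `δ > 0`) the kernels
`y ↦ (ρ, w) ↦ a • Σ_{v ∈ box} divV (fun κ u => c • M κ u ρ w) (Lc•y + v)` and their odd halves are `VertexFamily … Lc` families with ONE constant and rate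
`δ/2`, uniformly in `y`. -/
theorem vertexFamily_oddHalf_mixed {M : Fin (d + 1) → (Fin (d + 1) → ℤ) → Fin (d + 1) → (Fin (d + 1) → ℤ) → MKer (d + 1) (Fib d)} {C δ : ℝ}
    (hM : LocStencilFM Lc M C δ) (hδ : 0 < δ) (a c : ℝ) (y : Fin (d + 1) → ℤ) :
    VertexFamily (fun ρ w => ((1 : ℝ) / 2) • ((a • ∑ v ∈ box (d + 1) Lc, divV (fun κ u => c • M κ u ρ w) ((Lc : ℤ) • y + toSite v))
        - sgnK (trK (a • ∑ v ∈ box (d + 1) Lc, divV (fun κ u => c • M κ u ρ w) ((Lc : ℤ) • y + toSite v))))) Lc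
      (|a| * ∑ _i ∈ box (d + 1) Lc, ∑ _κ : Fin (d + 1), (|c| * C + |c| * C)) (δ / 2) := by
  intro ρ w
  have hC : 0 ≤ C := hM.nonneg
  refine biLoc_oddHalf (biLoc_smul_sum_divV (fun κ u => ?_) a _ _)
  have h1 : BiLoc (M κ u ρ w) ((Lc : ℤ) • w) ((Lc : ℤ) • w) C (δ / 2) := biLoc_recenter_half' hC hδ.le (hM κ u ρ w)
  exact biLoc_smul c h1

end Classes

/-! ## §4 The hW END from the five even-half Ward laws alone (`d = 3`, `T_W`, colour-free) -/

section End

variable {Lc N : ℕ} [NeZero Lc]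

/-- [folklore] **hW(v2.26-W) AT `T_W`, EVERY `SU(N)` (`2 ≤ N`), FROM THE FIVE EVEN-HALF WARD LAWS ALONE** (`d = 3`, `1 ≤ Lc`, in-block root, pin
`cE₂ = Lc^{2(3+1)}`): no residual tables, no class binders, no parity binders —
`WardLocusRecursiveLetters.wardTransversal_flipK_TbalOf_JsRecWAtOf_of_letters` at `T_W` with `RW = RW″ = 0` (Wilson sockets fed BY NAME by
`WilsonWardColourFree.hWil_wilson_TW_su`∕`''`) and `RB j Y`, `RB″ j Y`, `RM j y` := the ODD HALVES of the border (first∕second slot)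
and mixed Ward divergences (§1 `parityOdd_oddHalf`, `letter_of_evenHalf_law`, classes §3 `locStencil_oddHalf_border∕''`, `vertexFamily_oddHalf_mixed` from `hB`∕`hmix` at the common rate `min δ_B δ_M ∕ 2`). -/
theorem wardTransversal_flipK_TbalOf_JsRecWAtOf_TW_su_of_evenHalf_laws (hN : 2 ≤ N)
    (hLc : 1 ≤ Lc) {r : Fin (3 + 1) → ℕ} (hr : r ∈ box (3 + 1) Lc) (cΛ cB : ℝ) {cE₂ : ℝ}
    (hcE₂ : cE₂ = (Lc : ℝ) ^ (2 * (3 + 1)))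
    {vh₂S : Fin (3 + 1) → (Fin (3 + 1) → ℤ) → Fin (3 + 1) → (Fin (3 + 1) → ℤ) → MKer (3 + 1) (Fib 3)}
    (hB : ∃ C δ : ℝ, 0 < δ ∧ LocStencil₂ vh₂S C δ)
    (hBt : ∀ (κ : Fin (3 + 1)) (u : Fin (3 + 1) → ℤ) (κ' : Fin (3 + 1)) (u' t : Fin (3 + 1) → ℤ),
      vh₂S κ (u + (Lc : ℤ) • t) κ' (u' + (Lc : ℤ) • t) = shiftK (-((Lc : ℤ) • t)) (vh₂S κ u κ' u'))
    {mixFF : Fin (3 + 1) → (Fin (3 + 1) → ℤ) → Fin (3 + 1) → (Fin (3 + 1) → ℤ) → MKer (3 + 1) (Fib 3)}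
    (hmix : ∃ C δ : ℝ, 0 < δ ∧ LocStencilFM Lc mixFF C δ)
    (hmixt : ∀ (κ : Fin (3 + 1)) (u : Fin (3 + 1) → ℤ) (μ : Fin (3 + 1)) (w t : Fin (3 + 1) → ℤ),
      mixFF κ (u + (Lc : ℤ) • t) μ (w + t) = shiftK (-((Lc : ℤ) • t)) (mixFF κ u μ w))
    (hE0 : ∀ (Y : Fin (3 + 1) → ℤ) (κ' : Fin (3 + 1)) (u' : Fin (3 + 1) → ℤ),
      (stepScale 3 Lc 0 * (Lc : ℝ) ^ (3 + 1))⁻¹ • ∑ v ∈ box (3 + 1) Lc, divV (fun κ u => cB • vh₂S κ u κ' u') ((Lc : ℤ) • Y + toSite v)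
          + sgnK (trK ((stepScale 3 Lc 0 * (Lc : ℝ) ^ (3 + 1))⁻¹ • ∑ v ∈ box (3 + 1) Lc, divV (fun κ u => cB • vh₂S κ u κ' u') ((Lc : ℤ) • Y + toSite v))) =
        (2 : ℝ) • (comp ((-((Lc : ℝ) ^ (3 + 1) * (1 / 2) * (Lc : ℝ) ^ (3 + 1))) • vhSAt (toSite r) 3 Lc rfl κ' u') (diagK (((1 : ℝ) / 2) • ∑ v ∈ box (3 + 1) Lc, legInd (toSite r) ((Lc : ℤ) • Y + toSite v)))
          - comp (diagK (((1 : ℝ) / 2) • ∑ v ∈ box (3 + 1) Lc, legInd (toSite r) ((Lc : ℤ) • Y + toSite v))) ((-((Lc : ℝ) ^ (3 + 1) * (1 / 2) * (Lc : ℝ) ^ (3 + 1))) • vhSAt (toSite r) 3 Lc rfl κ' u')))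
    (hE0'' : ∀ (Y : Fin (3 + 1) → ℤ) (κ : Fin (3 + 1)) (u : Fin (3 + 1) → ℤ),
      (stepScale 3 Lc 0 * (Lc : ℝ) ^ (3 + 1))⁻¹ • ∑ v ∈ box (3 + 1) Lc, divV (fun κ' u' => cB • vh₂S κ u κ' u') ((Lc : ℤ) • Y + toSite v)
          + sgnK (trK ((stepScale 3 Lc 0 * (Lc : ℝ) ^ (3 + 1))⁻¹ • ∑ v ∈ box (3 + 1) Lc, divV (fun κ' u' => cB • vh₂S κ u κ' u') ((Lc : ℤ) • Y + toSite v))) =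
        (2 : ℝ) • (comp ((-((Lc : ℝ) ^ (3 + 1) * (1 / 2) * (Lc : ℝ) ^ (3 + 1))) • vhSAt (toSite r) 3 Lc rfl κ u) (diagK (((1 : ℝ) / 2) • ∑ v ∈ box (3 + 1) Lc, legInd (toSite r) ((Lc : ℤ) • Y + toSite v)))
          - comp (diagK (((1 : ℝ) / 2) • ∑ v ∈ box (3 + 1) Lc, legInd (toSite r) ((Lc : ℤ) • Y + toSite v))) ((-((Lc : ℝ) ^ (3 + 1) * (1 / 2) * (Lc : ℝ) ^ (3 + 1))) • vhSAt (toSite r) 3 Lc rfl κ u)))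
    (hES : ∀ (j : ℕ) (Y : Fin (3 + 1) → ℤ) (κ' : Fin (3 + 1)) (u' : Fin (3 + 1) → ℤ),
      (stepScale 3 Lc (j + 1) * (Lc : ℝ) ^ (3 + 1))⁻¹ •
          ∑ v ∈ box (3 + 1) Lc, divV (fun κ u => (cB * wB2 3 Lc (j + 1)) • vh₂S κ u κ' u') ((Lc : ℤ) • Y + toSite v)
          + sgnK (trK ((stepScale 3 Lc (j + 1) * (Lc : ℝ) ^ (3 + 1))⁻¹ •
          ∑ v ∈ box (3 + 1) Lc, divV (fun κ u => (cB * wB2 3 Lc (j + 1)) • vh₂S κ u κ' u') ((Lc : ℤ) • Y + toSite v))) =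
        (2 : ℝ) • (comp ((-((Lc : ℝ) ^ (3 + 1) * (1 / 2) * (Lc : ℝ) ^ (3 + 1)) * wVH 3 Lc (j + 1)) • vhSAt (toSite r) 3 Lc rfl κ' u') (diagK (((1 : ℝ) / 2) • ∑ v ∈ box (3 + 1) Lc, legInd (toSite r) ((Lc : ℤ) • Y + toSite v)))
          - comp (diagK (((1 : ℝ) / 2) • ∑ v ∈ box (3 + 1) Lc, legInd (toSite r) ((Lc : ℤ) • Y + toSite v))) ((-((Lc : ℝ) ^ (3 + 1) * (1 / 2) * (Lc : ℝ) ^ (3 + 1)) * wVH 3 Lc (j + 1)) • vhSAt (toSite r) 3 Lc rfl κ' u')))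
    (hES'' : ∀ (j : ℕ) (Y : Fin (3 + 1) → ℤ) (κ : Fin (3 + 1)) (u : Fin (3 + 1) → ℤ),
      (stepScale 3 Lc (j + 1) * (Lc : ℝ) ^ (3 + 1))⁻¹ •
          ∑ v ∈ box (3 + 1) Lc, divV (fun κ' u' => (cB * wB2 3 Lc (j + 1)) • vh₂S κ u κ' u') ((Lc : ℤ) • Y + toSite v)
          + sgnK (trK ((stepScale 3 Lc (j + 1) * (Lc : ℝ) ^ (3 + 1))⁻¹ •
          ∑ v ∈ box (3 + 1) Lc, divV (fun κ' u' => (cB * wB2 3 Lc (j + 1)) • vh₂S κ u κ' u') ((Lc : ℤ) • Y + toSite v))) =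
        (2 : ℝ) • (comp ((-((Lc : ℝ) ^ (3 + 1) * (1 / 2) * (Lc : ℝ) ^ (3 + 1)) * wVH 3 Lc (j + 1)) • vhSAt (toSite r) 3 Lc rfl κ u) (diagK (((1 : ℝ) / 2) • ∑ v ∈ box (3 + 1) Lc, legInd (toSite r) ((Lc : ℤ) • Y + toSite v)))
          - comp (diagK (((1 : ℝ) / 2) • ∑ v ∈ box (3 + 1) Lc, legInd (toSite r) ((Lc : ℤ) • Y + toSite v))) ((-((Lc : ℝ) ^ (3 + 1) * (1 / 2) * (Lc : ℝ) ^ (3 + 1)) * wVH 3 Lc (j + 1)) • vhSAt (toSite r) 3 Lc rfl κ u)))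
    (hEM : ∀ (j : ℕ) (y : Fin (3 + 1) → ℤ) (ρ' : Fin (3 + 1)) (w : Fin (3 + 1) → ℤ),
      (stepScale 3 Lc j * (Lc : ℝ) ^ (3 + 1))⁻¹ • ∑ v ∈ box (3 + 1) Lc, divV (fun κ u => M2Of 3 Lc mixFF j κ u ρ' w) ((Lc : ℤ) • y + toSite v)
          + sgnK (trK ((stepScale 3 Lc j * (Lc : ℝ) ^ (3 + 1))⁻¹ • ∑ v ∈ box (3 + 1) Lc, divV (fun κ u => M2Of 3 Lc mixFF j κ u ρ' w) ((Lc : ℤ) • y + toSite v))) =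
        (2 : ℝ) • (comp (M1At 3 Lc (toSite r) cΛ j ρ' w) (diagK (((1 : ℝ) / 2) • ∑ v ∈ box (3 + 1) Lc, legInd (toSite r) ((Lc : ℤ) • y + toSite v)))
          - comp (diagK (((1 : ℝ) / 2) • ∑ v ∈ box (3 + 1) Lc, legInd (toSite r) ((Lc : ℤ) • y + toSite v))) (M1At 3 Lc (toSite r) cΛ j ρ' w))) :
    ∀ j : ℕ, WardTransversal (flipK (TbalOf Lc
      (JsRecWAtOf (d := 3) hLc hr ((Lc : ℝ) ^ (3 + 1)) (-((Lc : ℝ) ^ (3 + 1) * (1 / 2) * (Lc : ℝ) ^ (3 + 1))) cΛ cE₂ cB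
        ((8 * (N : ℝ) ^ 2)⁻¹ • wsym22 N) hB hmix) j)) := by
  obtain ⟨CB, δB, hδB, hBl⟩ := id hB
  obtain ⟨CM, δM, hδM, hMl⟩ := id hmix
  -- the common class data of level `j`: constants of §3 of `WardLocusParitySplit`, rate `min δB δM / 2`
  have hcls : ∀ (a w c : ℝ),
      ∃ C δ : ℝ, 0 < δ ∧
        (∀ Y : Fin (3 + 1) → ℤ, LocStencil (fun κ' u' => ((1 : ℝ) / 2) •
            ((a • ∑ v ∈ box (3 + 1) Lc, divV (fun κ u => w • vh₂S κ u κ' u') ((Lc : ℤ) • Y + toSite v))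
              - sgnK (trK (a • ∑ v ∈ box (3 + 1) Lc, divV (fun κ u => w • vh₂S κ u κ' u') ((Lc : ℤ) • Y + toSite v))))) C δ) ∧
        (∀ Y : Fin (3 + 1) → ℤ, LocStencil (fun κ u => ((1 : ℝ) / 2) •
            ((a • ∑ v ∈ box (3 + 1) Lc, divV (fun κ' u' => w • vh₂S κ u κ' u') ((Lc : ℤ) • Y + toSite v))
              - sgnK (trK (a • ∑ v ∈ box (3 + 1) Lc, divV (fun κ' u' => w • vh₂S κ u κ' u') ((Lc : ℤ) • Y + toSite v))))) C δ) ∧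
        (∀ y : Fin (3 + 1) → ℤ, VertexFamily (fun ρ w' => ((1 : ℝ) / 2) •
            ((a • ∑ v ∈ box (3 + 1) Lc, divV (fun κ u => c • mixFF κ u ρ w') ((Lc : ℤ) • y + toSite v))
              - sgnK (trK (a • ∑ v ∈ box (3 + 1) Lc, divV (fun κ u => c • mixFF κ u ρ w') ((Lc : ℤ) • y + toSite v))))) Lc C δ) := by
    intro a w c
    have hKB : 0 ≤ |a| * ∑ _i ∈ box (3 + 1) Lc, ∑ _κ : Fin (3 + 1), (|w| * CB + |w| * CB) :=
      (locStencil_oddHalf_border (Lc := Lc) hBl hδB a w 0 0 0).nonneg (Sum.inl 0)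
    have hKM : 0 ≤ |a| * ∑ _i ∈ box (3 + 1) Lc, ∑ _κ : Fin (3 + 1), (|c| * CM + |c| * CM) :=
      (vertexFamily_oddHalf_mixed hMl hδM a c 0 0 0).nonneg (Sum.inl 0)
    refine ⟨|a| * ∑ _i ∈ box (3 + 1) Lc, ∑ _κ : Fin (3 + 1), (|w| * CB + |w| * CB) +
        |a| * ∑ _i ∈ box (3 + 1) Lc, ∑ _κ : Fin (3 + 1), (|c| * CM + |c| * CM), min δB δM / 2,
      by positivity, fun Y κ' u' => ?_, fun Y κ u => ?_, fun y ρ w' => ?_⟩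
    · exact biLoc_weaken (locStencil_oddHalf_border (Lc := Lc) hBl hδB a w Y κ' u') (by linarith)
        (by have := min_le_left δB δM; linarith)
    · exact biLoc_weaken (locStencil_oddHalf_border'' (Lc := Lc) hBl hδB a w Y κ u) (by linarith)
        (by have := min_le_left δB δM; linarith)
    · exact biLoc_weaken (vertexFamily_oddHalf_mixed hMl hδM a c y ρ w') (by linarith)
        (by have := min_le_right δB δM; linarith)
  have hZ : ∀ {C δ : ℝ}, 0 ≤ C → ∀ Y : Fin (3 + 1) → ℤ,
      LocStencil ((0 : (Fin (3 + 1) → ℤ) → Fin (3 + 1) → (Fin (3 + 1) → ℤ) → MKer (3 + 1) (Fib 3)) Y) C δ :=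
    fun hC Y κ u x z a b => by
      simp only [Pi.zero_apply, abs_zero]
      exact mul_nonneg hC (Real.exp_pos _).le
  have hcls' : ∀ (a w c : ℝ), ∃ C δ : ℝ, 0 < δ ∧
        (∀ Y : Fin (3 + 1) → ℤ, LocStencil ((0 : (Fin (3 + 1) → ℤ) → Fin (3 + 1) → (Fin (3 + 1) → ℤ) → MKer (3 + 1) (Fib 3)) Y) C δ) ∧
        (∀ Y : Fin (3 + 1) → ℤ, LocStencil ((0 : (Fin (3 + 1) → ℤ) → Fin (3 + 1) → (Fin (3 + 1) → ℤ) → MKer (3 + 1) (Fib 3)) Y) C δ) ∧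
        (∀ Y : Fin (3 + 1) → ℤ, LocStencil (fun κ' u' => ((1 : ℝ) / 2) •
            ((a • ∑ v ∈ box (3 + 1) Lc, divV (fun κ u => w • vh₂S κ u κ' u') ((Lc : ℤ) • Y + toSite v))
              - sgnK (trK (a • ∑ v ∈ box (3 + 1) Lc, divV (fun κ u => w • vh₂S κ u κ' u') ((Lc : ℤ) • Y + toSite v))))) C δ) ∧
        (∀ Y : Fin (3 + 1) → ℤ, LocStencil (fun κ u => ((1 : ℝ) / 2) •
            ((a • ∑ v ∈ box (3 + 1) Lc, divV (fun κ' u' => w • vh₂S κ u κ' u') ((Lc : ℤ) • Y + toSite v))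
              - sgnK (trK (a • ∑ v ∈ box (3 + 1) Lc, divV (fun κ' u' => w • vh₂S κ u κ' u') ((Lc : ℤ) • Y + toSite v))))) C δ) ∧
        (∀ y : Fin (3 + 1) → ℤ, VertexFamily (fun ρ w' => ((1 : ℝ) / 2) •
            ((a • ∑ v ∈ box (3 + 1) Lc, divV (fun κ u => c • mixFF κ u ρ w') ((Lc : ℤ) • y + toSite v))
              - sgnK (trK (a • ∑ v ∈ box (3 + 1) Lc, divV (fun κ u => c • mixFF κ u ρ w') ((Lc : ℤ) • y + toSite v))))) Lc C δ) := by
    intro a w c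
    obtain ⟨C, δ, hδ, h1, h2, h3⟩ := hcls a w c
    have hC : 0 ≤ C := (h3 0 0 0).nonneg (Sum.inl 0)
    exact ⟨C, δ, hδ, hZ hC, hZ hC, h1, h2, h3⟩
  refine wardTransversal_flipK_TbalOf_JsRecWAtOf_of_letters hLc hr cΛ cB hcE₂ ((8 * (N : ℝ) ^ 2)⁻¹ • wsym22 N) hB hmix
    (RW := 0) (RW'' := 0)
    (RB := fun j => Nat.rec (motive := fun _ => (Fin (3 + 1) → ℤ) → Fin (3 + 1) → (Fin (3 + 1) → ℤ) → MKer (3 + 1) (Fib 3))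
      (fun Y κ' u' => ((1 : ℝ) / 2) • (((stepScale 3 Lc 0 * (Lc : ℝ) ^ (3 + 1))⁻¹ • ∑ v ∈ box (3 + 1) Lc, divV (fun κ u => cB • vh₂S κ u κ' u') ((Lc : ℤ) • Y + toSite v)) - sgnK (trK ((stepScale 3 Lc 0 * (Lc : ℝ) ^ (3 + 1))⁻¹ • ∑ v ∈ box (3 + 1) Lc, divV (fun κ u => cB • vh₂S κ u κ' u') ((Lc : ℤ) • Y + toSite v)))))
      (fun j _ => fun Y κ' u' => ((1 : ℝ) / 2) • (((stepScale 3 Lc (j + 1) * (Lc : ℝ) ^ (3 + 1))⁻¹ •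
          ∑ v ∈ box (3 + 1) Lc, divV (fun κ u => (cB * wB2 3 Lc (j + 1)) • vh₂S κ u κ' u') ((Lc : ℤ) • Y + toSite v)) - sgnK (trK ((stepScale 3 Lc (j + 1) * (Lc : ℝ) ^ (3 + 1))⁻¹ •
          ∑ v ∈ box (3 + 1) Lc, divV (fun κ u => (cB * wB2 3 Lc (j + 1)) • vh₂S κ u κ' u') ((Lc : ℤ) • Y + toSite v))))) j)
    (RB'' := fun j => Nat.rec (motive := fun _ => (Fin (3 + 1) → ℤ) → Fin (3 + 1) → (Fin (3 + 1) → ℤ) → MKer (3 + 1) (Fib 3))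
      (fun Y κ u => ((1 : ℝ) / 2) • (((stepScale 3 Lc 0 * (Lc : ℝ) ^ (3 + 1))⁻¹ • ∑ v ∈ box (3 + 1) Lc, divV (fun κ' u' => cB • vh₂S κ u κ' u') ((Lc : ℤ) • Y + toSite v)) - sgnK (trK ((stepScale 3 Lc 0 * (Lc : ℝ) ^ (3 + 1))⁻¹ • ∑ v ∈ box (3 + 1) Lc, divV (fun κ' u' => cB • vh₂S κ u κ' u') ((Lc : ℤ) • Y + toSite v)))))
      (fun j _ => fun Y κ u => ((1 : ℝ) / 2) • (((stepScale 3 Lc (j + 1) * (Lc : ℝ) ^ (3 + 1))⁻¹ •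
          ∑ v ∈ box (3 + 1) Lc, divV (fun κ' u' => (cB * wB2 3 Lc (j + 1)) • vh₂S κ u κ' u') ((Lc : ℤ) • Y + toSite v)) - sgnK (trK ((stepScale 3 Lc (j + 1) * (Lc : ℝ) ^ (3 + 1))⁻¹ •
          ∑ v ∈ box (3 + 1) Lc, divV (fun κ' u' => (cB * wB2 3 Lc (j + 1)) • vh₂S κ u κ' u') ((Lc : ℤ) • Y + toSite v))))) j)
    (RM := fun j y ρ' w => ((1 : ℝ) / 2) • (((stepScale 3 Lc j * (Lc : ℝ) ^ (3 + 1))⁻¹ • ∑ v ∈ box (3 + 1) Lc, divV (fun κ u => M2Of 3 Lc mixFF j κ u ρ' w) ((Lc : ℤ) • y + toSite v)) - sgnK (trK ((stepScale 3 Lc j * (Lc : ℝ) ^ (3 + 1))⁻¹ • ∑ v ∈ box (3 + 1) Lc, divV (fun κ u => M2Of 3 Lc mixFF j κ u ρ' w) ((Lc : ℤ) • y + toSite v)))))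
    ?_ ?_ (fun Y κ u => parityOdd_zero) (fun Y κ u => parityOdd_zero) ?_ ?_ ?_
    (hWil_wilson_TW_su (d := 3) hN Lc r hcE₂) (hWil''_wilson_TW_su (d := 3) hN Lc r hcE₂) ?_ ?_ ?_ ?_ ?_ hBt hmixt
  · -- classes, level 0 (Wilson residuals zero)
    exact hcls' _ cB (wM2 3 Lc 0)
  · -- classes, level j+1
    exact fun j => hcls _ (cB * wB2 3 Lc (j + 1)) (wM2 3 Lc (j + 1))
  · intro j Y κ u; cases j <;> exact parityOdd_oddHalf _
  · intro j Y κ u; cases j <;> exact parityOdd_oddHalf _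
  · exact fun j y ρ' w => parityOdd_oddHalf _
  · exact fun Y κ' u' => letter_of_evenHalf_law (hE0 Y κ' u')
  · exact fun Y κ u => letter_of_evenHalf_law (hE0'' Y κ u)
  · exact fun j Y κ' u' => letter_of_evenHalf_law (hES j Y κ' u')
  · exact fun j Y κ u => letter_of_evenHalf_law (hES'' j Y κ u)
  · exact fun j y ρ' w => letter_of_evenHalf_law (hEM j y ρ' w)

end End

end Summit.QuantumFields.BalabanUV.Beta.WardLocusParitySplit

end
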